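/-
Copyright (c) 2026 the pub-hodgecm-mathlib formalisation cell (harness21).  Prover seat hodgecm-mathlib-F0P3a-p09 (g9); dealer LH4-plan (g7) WORDS #25∕#40∕#41 «LAYER C (C3c)
FILE 2», 2026-09-02.  Count-neutral base layer of the dyadic (D-UNR) column (FINDINGS #6∕#6′∕#14∕#17∕#19 of the LH4 board); CENSUS-C3-BorelCountsTrace 9b5d35604f8b6f1d §3∕§5.
-/
import Literature.NumberTheory.Automorphic.UnitaryThreeBorelCosetCountTrace          -- (C3c) FILE 1: `borel_conj_mem_flickerHK_iff_of_rel_normForm`, `trace_fibre_coord` (brings ★ (C3a) p851957, ★ (i))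
import Literature.NumberTheory.Automorphic.UnitaryThreePHTowerRhoUnramified         -- ★ C2-A p851992 (LH4-p01): the four `ρ_m`-heads `…_of_unram`
import Literature.NumberTheory.Automorphic.UnitaryThreeBorelCosetCountQuadratic     -- ★ A-p03: `natCard_subtype_comp_eq_mul`, `factor_mk_eq_zero_iff` (2-free CITE)
import Literature.NumberTheory.LocalFields.UnramifiedQuadraticNormFormCount         -- ★ #33 p852000 (B-p04): `natCard_pairs_norm_form_eq` (the 2-free pair count)
import HarnessLib

/-!
# Flicker's Prop. 10, fourth regime `ν = N₊ < 2m ≤ 2ν`, as a coset count in the TRACE FRAME — `F · q^m · q^{m−k} · q^{m−1}(q+1)` at every residue characteristic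

Topic `NumberTheory/Automorphic`; namespace `Literature.NumberTheory.Automorphic.UnitaryGroup`.  THEOREMS ONLY (no definition, no instance, no notation, no named fact,
no `sorry`); kernel lane.  Cell `pub/hodgecm-mathlib`, crux H413 = `stmt-HodgeConjecture-24833`; LAYER C block **(C3c) FILE 2** of the (D-UNR) type-(1) column (dealer
LH4-plan (g7) WORDS #25∕#40∕#41; this seat's CENSUS-C3 9b5d35604f8b6f1d §3 row `…InertCountJPos` ∕ §4 (I4); LH3-p01 (g7)'s CENSUS-C5-CountJPosTrace cc353b3a §4 docking list).
Twin of ★ `Automorphic/UnitaryThreeBorelCosetCountQuadratic` §2–§4 (A-p03 (g24): symmetric corner, `u_m` with `yσy = −2`, `LocalConjDatum`, pair count ★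
`natCard_pairs_norm_quadratic_eq (h2 : IsUnit 2)`) WITHOUT any `|2| = 1`: general corner `!![A,0,B₂p;0,b,0;B₂,0,D]`, level element `u_m^{(y,z)}`, datum
`UnramifiedLocalConjDatum` + the characteristic token `(h2 : (2 : K) ≠ 0)`, and Step D = ★ #33 `natCard_pairs_norm_form_eq` (B-p04 (g48), 2-free).

THE MATHEMATICS [Flicker1998UnitaryFL, Prop. 10 p. 86, case «`ν′ = ν″ < m`»], re-read in the `(ν, w)` normal form of ★ (C3a).  In the regime `|B₂| = |D − b| = |ϖ^ν|`,
`|A − D| < |B₂|`, `m ≤ ν`, `ν + k = 2m` (`k ≥ 1`), for `p = p(u,x,w₀) ∈ P_H` the condition «`p⁻¹ τ p ∈ H^K_m`» is (§1, ★ (C3a) `condition_four_iff_quadratic_normForm`)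
`|N(w)·n² + β(w)·n + p| ≤ |ϖ^k|` with `n = uσu = N(u w₀⁻¹)`, `w = x + z` on the TRACE FIBRE `w + σw = z + σz = −yσy` (a unit), `β(w) = β₁w + β₂σw`, `β₁ = (A − b)∕B₂`,
`β₂ = (D − b)∕B₂` — i.e. (§2) a predicate of `ρ_m(p) = (u w₀⁻¹, x) mod 𝓂^m` alone, namely (after the shift `x̄ ↦ w̄ = x̄ + z̄`) the predicate counted by ★ #33
`natCard_pairs_norm_form_eq` at `R = 𝒪[K]`: `N(w)` is a unit on the whole fibre because the fibre's TRACE is (★ core p851934 `isUnit_mul_map_of_isUnit_add_map`, FINDING #14 —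
this replaces ★'s `1 − x² = N(1+x)` unit BY `|2| = 1`), `β(w) = β₂·(w + σw) + (β₁ − β₂)·w` is a unit because `|β₂| = 1` and `|β₁ − β₂| = |A − D|∕|B₂| < 1`, `β(w)` is `σ̄`-fixed
modulo `𝓂^k` exactly when **`|σβ₁ − β₂| ≤ |ϖ^k|` — the σ-DEFECT HYPOTHESIS `hσd`, ★'s `|σd − d| ≤ |ϖ^k|` for `d = 2(A−b)∕B₂` WITHOUT THE FACTOR `2`** — and `p = B₁∕B₂` is
`σ`-fixed with `|p| < 1`.  The residual equation `n̄(N̄(w)n̄ + β̄(w)) = 0` has its unit root SIMPLE (derivative `−β̄(w)`) whatever `|2|` is, so the count is uniform: with the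
fibres of `ρ_m` on `P_H ⧸ (P_H ∩ H^K_m)` of common size `F` (`hfib`; `F = q^m`, Prop. 8) and image «unit × anti-fixed» (★ C2-A (H1)(H3) `…_of_unram`), §3 gives
`#{y ∈ P_H ⧸ (P_H ∩ H^K_m) : y⁻¹ τ y ∈ H^K_m} = F · q^m · q^{m−k} · q^{m−1}(q+1)` — ★'s right-hand side byte for byte (Flicker's `(1 + q⁻¹)q^{ν+2m}`), values-concrete, no `r`-type
term (FINDING #19-bis: door closed).  For the trace LITERAL `M_{b,π₁}(x₁,x₂,x₃)` (★ F1) the consumer discharges `hσd` by the one-line identity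
`(A − e)∕B₂ − σ((D − e)∕B₂) = (x₁ − e)(e − x₃)∕(e·B₂)` (from `b + σb = 1`), of size `|ϖ^{N₁+N₂−ν}| ≤ |ϖ^k|` iff `N₁ + N₂ ≥ 2m` — ★'s exponent, reached there through
`map_ratio_sub_ratio` and `|2| = 1`.
HONEST LABEL: HC_CM is proved only modulo the printed citations (hLiu418 = `stmt-HodgeConjecture-24832`, h413 = `stmt-HodgeConjecture-24833`) until rung 0 closes; (D-UNR)
stays PRINT by D74′; this file is count-neutral group bookkeeping + finite counting, it pays no organ and opens no road.

## References
* [Flicker1998UnitaryFL] Y. Z. Flicker, *Elementary proof of the fundamental lemma for a unitary group*, Canad. J. Math. 50 (1998), 74–98: Prop. 8 p. 84, Prop. 10 pp. 85–86.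
* [Rogawski1990] J. D. Rogawski, *Automorphic Representations of Unitary Groups in Three Variables* (1990), §4.9 p. 55 (the unit orbital integrals being computed).
-/

set_option autoImplicit false

open scoped MatrixGroups WithZero Valued
open Matrix

namespace Literature.NumberTheory.Automorphic

namespace UnitaryGroup

open Literature.NumberTheory.Automorphic.HermitianLattice (unitaryInt mem_unitaryInt_iff UnramifiedLocalConjDatum)
open Literature.NumberTheory.LocalFields.UnramifiedQuadraticNorm IsLocalRing

variable {K : Type*} [Field K] [Valued K ℤᵐ⁰] {ϖ : K} (σ : K →+* K) {J : Matrix (Fin 3) (Fin 3) K}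

/-! ## §1 Regime 4 in coordinates, trace frame: «`p⁻¹ τ p ∈ H^K_m`» ⟺ the norm-form valuation inequality -/

/-- **Regime 4 in coordinates, trace frame**: for `p = p(u,x,w₀) ∈ P_H`, `τ = !![A,0,B₂p; 0,b,0; B₂,0,D] ∈ H` with `|B₂| = |ϖ^ν|`, `|A − b|, |D − b| ≤ |ϖ^ν|`, `m ≤ ν`,
`ν + k = 2m`, and the level element `u_m^{(y,z)}`: `p⁻¹ τ p ∈ H^K_m ↔ |N(w)·n² + (β₁w + β₂σw)·n + p| ≤ |ϖ^k|` with `n = uσu`, `w = x + z`, `β₁ = (A−b)∕B₂`, `β₂ = (D−b)∕B₂`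
(★ (C3a) `condition_four_iff_quadratic_normForm`; conditions (1′)–(3′) hold automatically; twin of ★ `borel_conj_mem_flickerHK_iff_quadratic`). [cite: Flicker1998UnitaryFL, Prop. 10 p. 86] -/
theorem borel_conj_mem_flickerHK_iff_quadratic_of_rel (hJ : J = (StdForm.antidiagonal 3).over K) (hd : UnramifiedLocalConjDatum σ ϖ) (h2 : (2 : K) ≠ 0)
    {y z : K} (hy : Valued.v y = 1) (hzv : Valued.v z ≤ 1) (hz : z + σ z + y * σ y = 0)
    {m ν k : ℕ} (hmν : m ≤ ν) (hνk : ν + k = 2 * m)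
    {c um p τ : ↥(unitaryGroupOfForm σ J)} (hc : ((c : GL (Fin 3) K) : Matrix (Fin 3) (Fin 3) K) = !![1, 0, 0; 0, -1, 0; 0, 0, 1])
    (hum : ((um : GL (Fin 3) K) : Matrix (Fin 3) (Fin 3) K) = !![ϖ ^ m, y, z * (ϖ ^ m)⁻¹; 0, 1, -σ y * (ϖ ^ m)⁻¹; 0, 0, (ϖ ^ m)⁻¹])
    {u x w₀ A B₁ B₂ D b pp : K} (hp : p ∈ flickerPH σ J c)
    (hpm : ((p : GL (Fin 3) K) : Matrix (Fin 3) (Fin 3) K) = !![u, 0, u * x; 0, w₀, 0; 0, 0, (σ u)⁻¹])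
    (hB₁ : B₁ = B₂ * pp) (hτ : ((τ : GL (Fin 3) K) : Matrix (Fin 3) (Fin 3) K) = !![A, 0, B₁; 0, b, 0; B₂, 0, D])
    (hτH : τ ∈ Subgroup.centralizer ({c} : Set ↥(unitaryGroupOfForm σ J)))
    (hB₂ : Valued.v B₂ = Valued.v (ϖ ^ ν)) (hsA : Valued.v (A - b) ≤ Valued.v (ϖ ^ ν)) (hsD : Valued.v (D - b) ≤ Valued.v (ϖ ^ ν)) :
    p⁻¹ * τ * p ∈ flickerHK σ J c um ↔
      Valued.v ((x + z) * σ (x + z) * (u * σ u) ^ 2 + ((A - b) / B₂ * (x + z) + (D - b) / B₂ * σ (x + z)) * (u * σ u) + pp) ≤ Valued.v (ϖ ^ k) := by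
  have hϖ0 : ϖ ≠ 0 := hd.ϖ_ne_zero
  obtain ⟨u', x', w', hpm', hvu, hvx, hσx, hvw, -⟩ := exists_coe_eq_borel_of_mem_flickerPH' σ hJ hd.σσ hd.vσ h2 hc hp
  have hu' : u' = u := by have := congrFun (congrFun (hpm'.symm.trans hpm) 0) 0; simpa using this
  have hw' : w' = w₀ := by have := congrFun (congrFun (hpm'.symm.trans hpm) 1) 1; simpa using this
  subst hu' hw'
  have hu0 : u' ≠ 0 := fun h => by rw [h, map_zero] at hvu; exact zero_ne_one hvu
  have hx' : x' = x := by
    have := congrFun (congrFun (hpm'.symm.trans hpm) 0) 2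
    simpa [hu0] using this
  subst hx'
  have hσu0 : σ u' ≠ 0 := fun h => hu0 (by rw [← hd.σσ u', h, map_zero])
  have hw0 : w' ≠ 0 := fun h => by rw [h, map_zero] at hvw; exact zero_ne_one hvw
  have hpH : p ∈ Subgroup.centralizer ({c} : Set ↥(unitaryGroupOfForm σ J)) := ((mem_flickerPH_iff h2 hc).1 hp).1.1
  rw [borel_conj_mem_flickerHK_iff_of_rel_normForm σ hJ hd hy hz m hu0 hσu0 hw0 hσx hum hpm hτ hpH hτH rfl]
  have hn : Valued.v (u' * σ u') = 1 := by rw [map_mul, hd.vσ, hvu, mul_one]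
  have hB₂0 : B₂ ≠ 0 := fun h => by
    rw [h, map_zero] at hB₂; exact (pow_ne_zero _ hϖ0) ((map_eq_zero _).1 hB₂.symm)
  have hmν' : Valued.v (ϖ ^ ν) ≤ Valued.v (ϖ ^ m) := by
    rw [hd.v_pow, hd.v_pow, WithZero.exp_le_exp]; omega
  have hB₂m : Valued.v B₂ ≤ Valued.v (ϖ ^ m) := hB₂ ▸ hmν'
  obtain ⟨hwv, hσwv, -, -, -⟩ := trace_fibre_coord σ hd hy hzv hz hvx hσx
  have c1 : Valued.v ((u' * σ u') * B₂) ≤ 1 := by rw [map_mul, hn, one_mul]; exact le_trans hB₂m (hd.v_pow_le_one m)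
  have c23 := (conditions_two_three_iff_of_v_B₂_le σ hB₂m hn hwv hσwv).2 ⟨le_trans hsA hmν', le_trans hsD hmν'⟩
  rw [condition_four_iff_quadratic_normForm σ hB₂0 hn hB₁]
  have e : Valued.v (ϖ ^ m) * Valued.v (ϖ ^ m) = Valued.v (ϖ ^ ν) * Valued.v (ϖ ^ k) := by
    rw [← map_mul, ← map_mul, ← pow_add, ← pow_add]; congr 2; omega
  have eform : (u' * σ u') ^ 2 * ((x' + z) * σ (x' + z)) + ((A - b) * (x' + z) + (D - b) * σ (x' + z)) / B₂ * (u' * σ u') + pp =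
      (x' + z) * σ (x' + z) * (u' * σ u') ^ 2 + ((A - b) / B₂ * (x' + z) + (D - b) / B₂ * σ (x' + z)) * (u' * σ u') + pp := by
    rw [add_div, mul_div_right_comm, mul_div_right_comm (D - b)]; ring
  rw [eform]
  have hpos : 0 < Valued.v (ϖ ^ ν) := by rw [hd.v_pow]; exact WithZero.zero_lt_coe _
  constructor
  · rintro ⟨-, -, -, h4⟩
    rw [hB₂, e] at h4
    exact le_of_mul_le_mul_left h4 hpos
  · intro h4
    refine ⟨c1, c23.1, c23.2, ?_⟩
    rw [hB₂, e]
    exact mul_le_mul_right h4 _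

/-! ## §2 The norm-form inequality as a predicate on classes -/

/-- **The norm-form inequality as a predicate on classes**: for integers `a, w, β₁, β₂, p`, `|N(w)·N(a)² + (β₁w + β₂σw)·N(a) + p| ≤ |ϖ^k|` iff
`φ(w̄σ̄w̄·(āσ̄ā)² + (β̄₁w̄ + β̄₂σ̄w̄)·(āσ̄ā) + p̄) = 0` in `𝒪⧸𝓂^k` (classes mod `𝓂^m`, `k ≤ m`; twin of ★ `v_quadratic_le_iff_factor_eq_zero`). [cite: Flicker1998UnitaryFL, Prop. 10 p. 86] -/
theorem v_normForm_le_iff_factor_eq_zero (hd : UnramifiedLocalConjDatum σ ϖ) (hσO : ∀ y : 𝒪[K], (σ.comp 𝒪[K].subtype) y ∈ 𝒪[K])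
    {k m : ℕ} (hkm : k ≤ m) {a w β₁ β₂ pp : K} (ha : Valued.v a ≤ 1) (hw : Valued.v w ≤ 1) (hβ₁ : Valued.v β₁ ≤ 1) (hβ₂ : Valued.v β₂ ≤ 1)
    (hpp : Valued.v pp ≤ 1) :
    Valued.v (w * σ w * (a * σ a) ^ 2 + (β₁ * w + β₂ * σ w) * (a * σ a) + pp) ≤ Valued.v (ϖ ^ k) ↔
      Ideal.Quotient.factor (Ideal.pow_le_pow_right hkm)
        (Ideal.Quotient.mk (𝓂[K] ^ m) ⟨w, hw⟩ *
            Ideal.quotientMap (𝓂[K] ^ m) ((σ.comp 𝒪[K].subtype).codRestrict 𝒪[K] hσO)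
              (maximalIdeal_pow_le_comap_codRestrict σ hd.vϖ hd.vσ hσO m) (Ideal.Quotient.mk (𝓂[K] ^ m) ⟨w, hw⟩) *
            (Ideal.Quotient.mk (𝓂[K] ^ m) ⟨a, ha⟩ *
              Ideal.quotientMap (𝓂[K] ^ m) ((σ.comp 𝒪[K].subtype).codRestrict 𝒪[K] hσO)
                (maximalIdeal_pow_le_comap_codRestrict σ hd.vϖ hd.vσ hσO m) (Ideal.Quotient.mk (𝓂[K] ^ m) ⟨a, ha⟩)) ^ 2 +
          (Ideal.Quotient.mk (𝓂[K] ^ m) ⟨β₁, hβ₁⟩ * Ideal.Quotient.mk (𝓂[K] ^ m) ⟨w, hw⟩ +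
              Ideal.Quotient.mk (𝓂[K] ^ m) ⟨β₂, hβ₂⟩ *
                Ideal.quotientMap (𝓂[K] ^ m) ((σ.comp 𝒪[K].subtype).codRestrict 𝒪[K] hσO)
                  (maximalIdeal_pow_le_comap_codRestrict σ hd.vϖ hd.vσ hσO m) (Ideal.Quotient.mk (𝓂[K] ^ m) ⟨w, hw⟩)) *
            (Ideal.Quotient.mk (𝓂[K] ^ m) ⟨a, ha⟩ *
              Ideal.quotientMap (𝓂[K] ^ m) ((σ.comp 𝒪[K].subtype).codRestrict 𝒪[K] hσO)
                (maximalIdeal_pow_le_comap_codRestrict σ hd.vϖ hd.vσ hσO m) (Ideal.Quotient.mk (𝓂[K] ^ m) ⟨a, ha⟩)) +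
          Ideal.Quotient.mk (𝓂[K] ^ m) ⟨pp, hpp⟩) = 0 := by
  have hσa : Valued.v (σ a) ≤ 1 := by rw [hd.vσ]; exact ha
  have hσw : Valued.v (σ w) ≤ 1 := by rw [hd.vσ]; exact hw
  set E₀ : 𝒪[K] := ⟨w, hw⟩ * ⟨σ w, hσw⟩ * (⟨a, ha⟩ * ⟨σ a, hσa⟩) ^ 2 + (⟨β₁, hβ₁⟩ * ⟨w, hw⟩ + ⟨β₂, hβ₂⟩ * ⟨σ w, hσw⟩) * (⟨a, ha⟩ * ⟨σ a, hσa⟩) +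
    ⟨pp, hpp⟩ with hE₀
  have hcoe : (E₀ : K) = w * σ w * (a * σ a) ^ 2 + (β₁ * w + β₂ * σ w) * (a * σ a) + pp := by
    simp [hE₀]
  have hσmk : ∀ (t : K) (ht : Valued.v t ≤ 1) (hσt : Valued.v (σ t) ≤ 1),
      Ideal.quotientMap (𝓂[K] ^ m) ((σ.comp 𝒪[K].subtype).codRestrict 𝒪[K] hσO)
        (maximalIdeal_pow_le_comap_codRestrict σ hd.vϖ hd.vσ hσO m) (Ideal.Quotient.mk (𝓂[K] ^ m) ⟨t, ht⟩) =
        Ideal.Quotient.mk (𝓂[K] ^ m) ⟨σ t, hσt⟩ := fun t ht hσt => by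
    rw [Ideal.quotientMap_mk]; rfl
  rw [hσmk a ha hσa, hσmk w hw hσw, ← hcoe, ← factor_mk_eq_zero_iff hd.vϖ hkm E₀]
  simp only [hE₀, map_add, map_mul, map_pow]

/-! ## §3 The coset count in regime 4, trace frame -/

section RegimeFour

variable [IsDiscreteValuationRing 𝒪[K]] [Finite (ResidueField 𝒪[K])] [IsAdicComplete (maximalIdeal 𝒪[K]) 𝒪[K]]

/-- **PROP. 10, FOURTH REGIME, AS A COSET COUNT — TRACE FRAME, every residue characteristic** (`|B₂| = |D − b| = |ϖ^ν|`, `|A − D| < |B₂|`, `1 ≤ m ≤ ν`, `ν + k = 2m`,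
`k ≥ 1`, `B₁ = B₂·p` with `σp = p`, `|p| < 1`, and the σ-defect `|σ((A − b)∕B₂) − (D − b)∕B₂| ≤ |ϖ^k|` — ★'s `hσd` WITHOUT the factor `2`): for the level element
`u_m^{(y,z)}`, `#{y ∈ P_H ⧸ (P_H ∩ H^K_m) : y⁻¹ τ y ∈ H^K_m} = F · q^m · q^{m−k} · q^{m−1}(q+1)`, `F` the common size of the fibres of `ρ_m` on the coset space (`hfib`;
`F = q^m`) — Flicker's `(1 + q⁻¹)q^{ν+2m}`, values-concrete.  Ingredients: §1–§2 (the condition is the norm-form predicate of `ρ_m`), ★ C2-A (H1)(H3) `…_of_unram`, ★ #33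
`natCard_pairs_norm_form_eq` at `R = 𝒪[K]` after the shift `x̄ ↦ x̄ + z̄` (twin of ★ `natCard_cosets_regime_four`). [cite: Flicker1998UnitaryFL, Prop. 10 p. 86; Prop. 8 p. 84] -/
theorem natCard_cosets_regime_four_of_rel (hJ : J = (StdForm.antidiagonal 3).over K) (hd : UnramifiedLocalConjDatum σ ϖ) (h2 : (2 : K) ≠ 0)
    (hσO : ∀ y : 𝒪[K], (σ.comp 𝒪[K].subtype) y ∈ 𝒪[K])
    {y z : K} (hy : Valued.v y = 1) (hzv : Valued.v z ≤ 1) (hz : z + σ z + y * σ y = 0)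
    {m ν k : ℕ} (hm : 1 ≤ m) (hmν : m ≤ ν) (hνk : ν + k = 2 * m) (hk : 1 ≤ k)
    {c um τ : ↥(unitaryGroupOfForm σ J)} (hc : ((c : GL (Fin 3) K) : Matrix (Fin 3) (Fin 3) K) = !![1, 0, 0; 0, -1, 0; 0, 0, 1])
    (hum : ((um : GL (Fin 3) K) : Matrix (Fin 3) (Fin 3) K) = !![ϖ ^ m, y, z * (ϖ ^ m)⁻¹; 0, 1, -σ y * (ϖ ^ m)⁻¹; 0, 0, (ϖ ^ m)⁻¹])
    {A B₁ B₂ D b pp : K} (hB₁ : B₁ = B₂ * pp) (hvp : Valued.v pp < 1) (hσp : σ pp = pp)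
    (hτ : ((τ : GL (Fin 3) K) : Matrix (Fin 3) (Fin 3) K) = !![A, 0, B₁; 0, b, 0; B₂, 0, D])
    (hτH : τ ∈ Subgroup.centralizer ({c} : Set ↥(unitaryGroupOfForm σ J)))
    (hB₂ : Valued.v B₂ = Valued.v (ϖ ^ ν)) (hs : Valued.v (D - b) = Valued.v (ϖ ^ ν)) (hAD : Valued.v (A - D) < Valued.v B₂)
    (hσd : Valued.v (σ ((A - b) / B₂) - (D - b) / B₂) ≤ Valued.v (ϖ ^ k))
    {q : ℕ} (hq : Nat.card (ResidueField 𝒪[K]) = q ^ 2)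
    {a₀ : 𝒪[K]} (ha₀ : IsUnit (((σ.comp 𝒪[K].subtype).codRestrict 𝒪[K] hσO) a₀ - a₀))
    (hSN : flickerPH σ J c ⊓ flickerHK σ J c um ≤ flickerPH0 σ J c (ϖ ^ m))
    [Finite (↥(flickerPH σ J c) ⧸ (flickerHK σ J c um).subgroupOf (flickerPH σ J c))] {F : ℕ}
    (hfib : ∀ t ∈ Set.range (fun w : ↥(flickerPH σ J c) ⧸ (flickerHK σ J c um).subgroupOf (flickerPH σ J c) =>
        flickerPHRho σ m ((Quotient.out w : ↥(flickerPH σ J c)) : ↥(unitaryGroupOfForm σ J))),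
      Nat.card {w : ↥(flickerPH σ J c) ⧸ (flickerHK σ J c um).subgroupOf (flickerPH σ J c) //
        flickerPHRho σ m ((Quotient.out w : ↥(flickerPH σ J c)) : ↥(unitaryGroupOfForm σ J)) = t} = F) :
    Nat.card {w : ↥(flickerPH σ J c) ⧸ (flickerHK σ J c um).subgroupOf (flickerPH σ J c) //
      ((Quotient.out w : ↥(flickerPH σ J c)) : ↥(unitaryGroupOfForm σ J))⁻¹ * τ * (Quotient.out w : ↥(flickerPH σ J c)) ∈ flickerHK σ J c um} =
      F * (q ^ m * (q ^ (m - k) * (q ^ (m - 1) * (q + 1)))) := by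
  classical
  have hϖ0 : ϖ ≠ 0 := hd.ϖ_ne_zero
  have hkm : k ≤ m := by omega
  -- the restricted involution and the data in `𝒪[K]`
  set σO : 𝒪[K] →+* 𝒪[K] := (σ.comp 𝒪[K].subtype).codRestrict 𝒪[K] hσO with hσOdef
  have hσOσO : ∀ t, σO (σO t) = t := fun t => Subtype.ext (hd.σσ (t : K))
  have hB₂0 : B₂ ≠ 0 := fun h => by
    rw [h, map_zero] at hB₂; exact (pow_ne_zero _ hϖ0) ((map_eq_zero _).1 hB₂.symm)
  have hB₂pos : 0 < Valued.v B₂ := (Valuation.pos_iff _).2 hB₂0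
  -- the two diagonal defects and the coefficients `β₁ = (A − b)∕B₂`, `β₂ = (D − b)∕B₂`
  have hsA : Valued.v (A - b) ≤ Valued.v (ϖ ^ ν) := by
    have e : A - b = (A - D) + (D - b) := by ring
    rw [e]; exact le_trans (Valuation.map_add _ _ _) (max_le (le_of_lt (lt_of_lt_of_eq hAD hB₂)) hs.le)
  have hβ₁v : Valued.v ((A - b) / B₂) ≤ 1 := by
    rw [map_div₀, div_le_one₀ hB₂pos, hB₂]; exact hsA
  have hβ₂1 : Valued.v ((D - b) / B₂) = 1 := by
    rw [map_div₀, hs, hB₂, div_self (ne_of_gt (hB₂ ▸ hB₂pos))]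
  have hβ₂v : Valued.v ((D - b) / B₂) ≤ 1 := hβ₂1.le
  have hβ12 : Valued.v ((A - b) / B₂ - (D - b) / B₂) < 1 := by
    rw [← sub_div, show A - b - (D - b) = A - D by ring, map_div₀, div_lt_one₀ hB₂pos]; exact hAD
  set β₁O : 𝒪[K] := ⟨(A - b) / B₂, hβ₁v⟩ with hβ₁O
  set β₂O : 𝒪[K] := ⟨(D - b) / B₂, hβ₂v⟩ with hβ₂O
  set p₀ : 𝒪[K] := ⟨pp, hvp.le⟩ with hp₀
  set z₀ : 𝒪[K] := ⟨z, hzv⟩ with hz₀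
  have hp₀m : p₀ ∈ 𝓂[K] := by
    rw [mem_maximalIdeal, mem_nonunits_iff, Valuation.Integers.isUnit_iff_valuation_eq_one (Valuation.integer.integers _)]
    exact ne_of_lt hvp
  have hσp₀ : σO p₀ = p₀ := Subtype.ext (by change σ pp = pp; exact hσp)
  have hσβ : σO β₁O - β₂O ∈ 𝓂[K] ^ k := by
    rw [mem_maximalIdeal_pow_iff_v_le hd.vϖ]; exact hσd
  -- the trace of the fibre is a unit
  have htrz : Valued.v (z + σ z) = 1 := by
    have e : z + σ z = -(y * σ y) := by linear_combination hz
    rw [e, Valuation.map_neg, map_mul, hd.vσ, hy, mul_one]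
  have hzu : IsUnit (z₀ + σO z₀) :=
    (Valuation.Integers.isUnit_iff_valuation_eq_one (Valuation.integer.integers _)).2 (by change Valued.v (z + σ z) = 1; exact htrz)
  -- the predicate counted by the pair count (in the `ρ_m` currency `(ū, x̄)`, `x̄` anti-fixed), and the map `f = ρ_m ∘ out`
  set P := flickerPH σ J c with hPdef
  set S := (flickerHK σ J c um).subgroupOf (flickerPH σ J c) with hSdef
  set f : ↥P ⧸ S → (𝒪[K] ⧸ 𝓂[K] ^ m) × (𝒪[K] ⧸ 𝓂[K] ^ m) :=
    fun w => flickerPHRho σ m ((Quotient.out w : ↥P) : ↥(unitaryGroupOfForm σ J)) with hfdef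
  set Q : (𝒪[K] ⧸ 𝓂[K] ^ m) × (𝒪[K] ⧸ 𝓂[K] ^ m) → Prop := fun ux =>
    Ideal.quotientMap (maximalIdeal 𝒪[K] ^ m) σO (maximalIdeal_pow_le_comap σO hσOσO m) ux.2 = -ux.2 ∧ (IsUnit ux.1 ∧
      Ideal.Quotient.factor (Ideal.pow_le_pow_right hkm)
        ((ux.2 + Ideal.Quotient.mk _ z₀) * Ideal.quotientMap (maximalIdeal 𝒪[K] ^ m) σO (maximalIdeal_pow_le_comap σO hσOσO m) (ux.2 + Ideal.Quotient.mk _ z₀) *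
            (ux.1 * Ideal.quotientMap (maximalIdeal 𝒪[K] ^ m) σO (maximalIdeal_pow_le_comap σO hσOσO m) ux.1) ^ 2 +
          (Ideal.Quotient.mk _ β₁O * (ux.2 + Ideal.Quotient.mk _ z₀) +
              Ideal.Quotient.mk _ β₂O * Ideal.quotientMap (maximalIdeal 𝒪[K] ^ m) σO (maximalIdeal_pow_le_comap σO hσOσO m) (ux.2 + Ideal.Quotient.mk _ z₀)) *
            (ux.1 * Ideal.quotientMap (maximalIdeal 𝒪[K] ^ m) σO (maximalIdeal_pow_le_comap σO hσOσO m) ux.1) +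
          Ideal.Quotient.mk _ p₀) = 0) with hQdef
  have hσbar : Ideal.quotientMap (maximalIdeal 𝒪[K] ^ m) σO (maximalIdeal_pow_le_comap σO hσOσO m) =
      Ideal.quotientMap (𝓂[K] ^ m) ((σ.comp 𝒪[K].subtype).codRestrict 𝒪[K] hσO) (maximalIdeal_pow_le_comap_codRestrict σ hd.vϖ hd.vσ hσO m) := rfl
  -- Step A: «good» ⟺ `Q ∘ f`
  have stepA : ∀ w : ↥P ⧸ S, ((Quotient.out w : ↥P) : ↥(unitaryGroupOfForm σ J))⁻¹ * τ * (Quotient.out w : ↥P) ∈ flickerHK σ J c um ↔ Q (f w) := by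
    intro w
    set pq : ↥(unitaryGroupOfForm σ J) := ((Quotient.out w : ↥P) : ↥(unitaryGroupOfForm σ J)) with hpq
    have hp : pq ∈ flickerPH σ J c := (Quotient.out w).2
    obtain ⟨u, x, wc, hpm, hvu, hvx, hσx, hvw, hσw⟩ := exists_coe_eq_borel_of_mem_flickerPH' σ hJ hd.σσ hd.vσ h2 hc hp
    have hu0 : u ≠ 0 := fun h => by rw [h, map_zero] at hvu; exact zero_ne_one hvu
    have hw0 : wc ≠ 0 := fun h => by rw [h, map_zero] at hvw; exact zero_ne_one hvw
    have hva : Valued.v (u * wc⁻¹) ≤ 1 := by rw [map_mul, map_inv₀, hvu, hvw, inv_one, one_mul]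
    have hρ : f w = (Ideal.Quotient.mk (𝓂[K] ^ m) ⟨u * wc⁻¹, hva⟩, Ideal.Quotient.mk (𝓂[K] ^ m) ⟨x, hvx⟩) := by
      show flickerPHRho σ m pq = _
      rw [flickerPHRho_of_coe_eq σ m hpm hu0, toQuotPow_of_le m hva, toQuotPow_of_le m hvx]
    have hQ1 : Ideal.quotientMap (maximalIdeal 𝒪[K] ^ m) σO (maximalIdeal_pow_le_comap σO hσOσO m) (f w).2 = -(f w).2 := by
      rw [hσbar]; exact quotientMap_flickerPHRho_snd_of_unram σ hJ hd h2 hσO hc m hp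
    have hQ2 : IsUnit (f w).1 := isUnit_flickerPHRho_fst_of_unram σ hJ hd h2 hc m hp
    rw [borel_conj_mem_flickerHK_iff_quadratic_of_rel σ hJ hd h2 hy hzv hz hmν hνk hc hum hp hpm hB₁ hτ hτH hB₂ hsA hs.le]
    -- rewrite `uσu = N(u wc⁻¹)`
    have hσwc : σ wc = wc⁻¹ := eq_inv_of_mul_eq_one_left hσw
    have hN : u * σ u = (u * wc⁻¹) * σ (u * wc⁻¹) := by
      rw [map_mul, map_inv₀, hσwc, inv_inv]; field_simp
    obtain ⟨hwv, -, -, -, -⟩ := trace_fibre_coord σ hd hy hzv hz hvx hσx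
    rw [hN, v_normForm_le_iff_factor_eq_zero σ hd hσO hkm hva hwv hβ₁v hβ₂v hvp.le]
    have hxz : Ideal.Quotient.mk (𝓂[K] ^ m) (⟨x + z, hwv⟩ : 𝒪[K]) = Ideal.Quotient.mk (𝓂[K] ^ m) ⟨x, hvx⟩ + Ideal.Quotient.mk (𝓂[K] ^ m) z₀ := by
      rw [← map_add]; rfl
    rw [hxz]
    rw [hρ] at hQ1 hQ2
    rw [hQdef, hρ]
    exact ⟨fun h => ⟨hQ1, hQ2, h⟩, fun h => h.2.2⟩
  -- Step B: count through `f`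
  rw [Nat.card_congr (Equiv.subtypeEquivRight stepA), natCard_subtype_comp_eq_mul f Q F hfib]
  congr 1
  -- Step C: the range condition is implied by `Q` (★ C2-A (H3) surjectivity + (H1) + `S ≤ N₀`)
  have stepC : ∀ t, Q t → t ∈ Set.range f := by
    rintro ⟨α, β⟩ ⟨hβ, hα, -⟩
    obtain ⟨a, rfl⟩ := Ideal.Quotient.mk_surjective α
    obtain ⟨bb, rfl⟩ := Ideal.Quotient.mk_surjective β
    have hau : IsUnit a := isUnit_of_isUnit_mk_pow (R := 𝒪[K]) hm hα
    have hav : Valued.v (a : K) = 1 := (Valuation.Integers.isUnit_iff_valuation_eq_one (Valuation.integer.integers _)).1 hau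
    rw [hσbar] at hβ
    obtain ⟨pq, hpq, hρ⟩ := exists_mem_flickerPH_flickerPHRho_eq_of_unram σ hJ hd h2 hσO hc m a bb hav hβ
    refine ⟨QuotientGroup.mk ⟨pq, hpq⟩, ?_⟩
    obtain ⟨s, hs'⟩ := QuotientGroup.mk_out_eq_mul S (⟨pq, hpq⟩ : ↥P)
    show flickerPHRho σ m ((Quotient.out (QuotientGroup.mk (⟨pq, hpq⟩ : ↥P) : ↥P ⧸ S) : ↥P) : ↥(unitaryGroupOfForm σ J)) = _
    rw [hs', Subgroup.coe_mul, ← hρ]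
    symm
    rw [flickerPHRho_eq_iff_of_unram σ hJ hd h2 hc m hpq (Subgroup.mul_mem _ hpq (s : ↥P).2), ← mul_assoc, inv_mul_cancel, one_mul]
    exact hSN ⟨(s : ↥P).2, s.2⟩
  rw [Nat.card_congr (Equiv.subtypeEquivRight fun t => (and_iff_right_of_imp (stepC t) : t ∈ Set.range f ∧ Q t ↔ Q t))]
  -- Step D: shift `x̄ ↦ w̄ = x̄ + z̄` onto the trace fibre and apply ★ #33's pair count at `R = 𝒪[K]`
  have hz' : IsUnit (Ideal.Quotient.factor (Ideal.pow_le_pow_right hkm)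
      (Ideal.Quotient.mk (maximalIdeal 𝒪[K] ^ m) z₀ +
        Ideal.quotientMap (maximalIdeal 𝒪[K] ^ m) σO (maximalIdeal_pow_le_comap σO hσOσO m) (Ideal.Quotient.mk (maximalIdeal 𝒪[K] ^ m) z₀))) := by
    rw [Ideal.quotientMap_mk, ← map_add, Ideal.Quotient.factor_mk]
    exact hzu.map _
  have hβ' : Ideal.quotientMap (maximalIdeal 𝒪[K] ^ k) σO (maximalIdeal_pow_le_comap σO hσOσO k)
      (Ideal.Quotient.factor (Ideal.pow_le_pow_right hkm) (Ideal.Quotient.mk (maximalIdeal 𝒪[K] ^ m) β₁O)) =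
      Ideal.Quotient.factor (Ideal.pow_le_pow_right hkm) (Ideal.Quotient.mk (maximalIdeal 𝒪[K] ^ m) β₂O) := by
    rw [Ideal.Quotient.factor_mk, Ideal.Quotient.factor_mk, Ideal.quotientMap_mk, Ideal.Quotient.eq]
    exact hσβ
  have hp₀' : IsNilpotent (Ideal.Quotient.factor (Ideal.pow_le_pow_right hkm) (Ideal.Quotient.mk (maximalIdeal 𝒪[K] ^ m) p₀)) := by
    refine ⟨k, ?_⟩
    rw [Ideal.Quotient.factor_mk, ← map_pow, Ideal.Quotient.eq_zero_iff_mem]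
    exact Ideal.pow_mem_pow hp₀m k
  have hσp₀' : Ideal.quotientMap (maximalIdeal 𝒪[K] ^ k) σO (maximalIdeal_pow_le_comap σO hσOσO k)
      (Ideal.Quotient.factor (Ideal.pow_le_pow_right hkm) (Ideal.Quotient.mk (maximalIdeal 𝒪[K] ^ m) p₀)) =
      Ideal.Quotient.factor (Ideal.pow_le_pow_right hkm) (Ideal.Quotient.mk (maximalIdeal 𝒪[K] ^ m) p₀) := by
    rw [Ideal.Quotient.factor_mk, Ideal.quotientMap_mk, hσp₀]
  have hβu' : ∀ w : 𝒪[K] ⧸ maximalIdeal 𝒪[K] ^ m,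
      w + Ideal.quotientMap (maximalIdeal 𝒪[K] ^ m) σO (maximalIdeal_pow_le_comap σO hσOσO m) w =
        Ideal.Quotient.mk (maximalIdeal 𝒪[K] ^ m) z₀ +
          Ideal.quotientMap (maximalIdeal 𝒪[K] ^ m) σO (maximalIdeal_pow_le_comap σO hσOσO m) (Ideal.Quotient.mk (maximalIdeal 𝒪[K] ^ m) z₀) →
      IsUnit (Ideal.Quotient.factor (Ideal.pow_le_pow_right hkm)
        (Ideal.Quotient.mk (maximalIdeal 𝒪[K] ^ m) β₁O * w +
          Ideal.Quotient.mk (maximalIdeal 𝒪[K] ^ m) β₂O * Ideal.quotientMap (maximalIdeal 𝒪[K] ^ m) σO (maximalIdeal_pow_le_comap σO hσOσO m) w)) := by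
    intro w hw
    obtain ⟨wO, rfl⟩ := Ideal.Quotient.mk_surjective w
    rw [Ideal.quotientMap_mk, Ideal.quotientMap_mk, ← map_add, ← map_add, Ideal.Quotient.eq, mem_maximalIdeal_pow_iff_v_le hd.vϖ] at hw
    -- `|w + σw| = 1` because it agrees with the fibre's trace modulo `𝓂^m`, `m ≥ 1`
    have hm1 : Valued.v (ϖ ^ m) < 1 := by rw [hd.v_pow, ← WithZero.exp_zero, WithZero.exp_lt_exp]; omega
    have htrw : Valued.v ((wO : K) + σ (wO : K)) = 1 := by
      have e : (wO : K) + σ (wO : K) = (z + σ z) + (((wO : K) + σ (wO : K)) - (z + σ z)) := by ring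
      rw [e, Valuation.map_add_eq_of_lt_left _ (by rw [htrz]; exact lt_of_le_of_lt hw hm1), htrz]
    -- `β₁ w + β₂ σw = β₂ (w + σw) + (β₁ − β₂) w` is a unit
    have hmain : Valued.v ((D - b) / B₂ * ((wO : K) + σ (wO : K))) = 1 := by rw [map_mul, hβ₂1, htrw, one_mul]
    have hsmall : Valued.v (((A - b) / B₂ - (D - b) / B₂) * (wO : K)) < 1 :=
      lt_of_le_of_lt (by rw [map_mul]; exact mul_le_of_le_one_right zero_le wO.2) hβ12
    have hunit : Valued.v ((A - b) / B₂ * (wO : K) + (D - b) / B₂ * σ (wO : K)) = 1 := by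
      have e : (A - b) / B₂ * (wO : K) + (D - b) / B₂ * σ (wO : K) =
          (D - b) / B₂ * ((wO : K) + σ (wO : K)) + ((A - b) / B₂ - (D - b) / B₂) * (wO : K) := by ring
      rw [e, Valuation.map_add_eq_of_lt_left _ (by rw [hmain]; exact hsmall), hmain]
    rw [Ideal.quotientMap_mk, ← map_mul, ← map_mul, ← map_add, Ideal.Quotient.factor_mk]
    refine IsUnit.map _ ((Valuation.Integers.isUnit_iff_valuation_eq_one (Valuation.integer.integers _)).2 ?_)
    change Valued.v ((A - b) / B₂ * (wO : K) + (D - b) / B₂ * σ (wO : K)) = 1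
    exact hunit
  rw [← natCard_pairs_norm_form_eq σO hσOσO ha₀ hq hk hkm (Ideal.Quotient.mk _ z₀) (Ideal.Quotient.mk _ β₁O) (Ideal.Quotient.mk _ β₂O)
    (Ideal.Quotient.mk _ p₀) hz' hβ' hp₀' hσp₀' hβu']
  refine Nat.card_congr
    { toFun := fun ux => ⟨(ux.1.1, ux.1.2 + Ideal.Quotient.mk _ z₀), ?_⟩
      invFun := fun uw => ⟨(uw.1.1, uw.1.2 - Ideal.Quotient.mk _ z₀), ?_⟩
      left_inv := fun ux => Subtype.ext (Prod.ext rfl (add_sub_cancel_right _ _))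
      right_inv := fun uw => Subtype.ext (Prod.ext rfl (sub_add_cancel _ _)) }
  · obtain ⟨⟨uu, xx⟩, hx, hu, hφ⟩ := ux
    refine ⟨?_, hu, hφ⟩
    show xx + Ideal.Quotient.mk _ z₀ + Ideal.quotientMap (maximalIdeal 𝒪[K] ^ m) σO (maximalIdeal_pow_le_comap σO hσOσO m) (xx + Ideal.Quotient.mk _ z₀) = _
    rw [map_add, hx]; ring
  · obtain ⟨⟨uu, ww⟩, hw, hu, hφ⟩ := uw
    refine ⟨?_, hu, ?_⟩
    · show Ideal.quotientMap (maximalIdeal 𝒪[K] ^ m) σO (maximalIdeal_pow_le_comap σO hσOσO m) (ww - Ideal.Quotient.mk _ z₀) = -(ww - Ideal.Quotient.mk _ z₀)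
      rw [map_sub]; linear_combination hw
    · show Ideal.Quotient.factor (Ideal.pow_le_pow_right hkm) _ = 0
      simpa only [sub_add_cancel] using hφ

end RegimeFour

end UnitaryGroup

end Literature.NumberTheory.Automorphic
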